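import Summits.Ventures.CertifiedManyBodySolver.Observables.TISourcedClusterTrialRowsInterval
import Summits.Ventures.CertifiedManyBodySolver.Observables.TISourcedMinimiserChordFloorExact
import HarnessLib

/-!
# The four-corner rule at general `t′`: two INTERVAL-density cluster caps of the `t–t′` box bracketing the target
# density ⇒ the canonical `hcap` and the exact-minimiser chord floor

Cell hubbard-cq (rung CQ, CQ-TABLE §A0 canonical column; seat hubbard-cq-obsth-2, successor item of the g5 HANDOFF: «A0 (t′ = −¼)
TWO-W5 editions — both W5 boxes transported by their K₂ rows»). `TISourcedClusterTrialRowsTwoIntervals.lean` (p479142) proved the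
FOUR-CORNER RULE at `t′ = 0` in NODE shape; p6's `TISourcedClusterTrialRowsInterval.lean` (p475630) has the general-`tp` ONE-interval rules
`exists_canonicalClass_sourced_le_of_clusterCapInterval_of_clusterCapTT'` / `…_of_clusterCap_of_clusterCapIntervalTT'` in VECTOR shape.
This file is the missing corner of that square: the general-`tp` four-corner rule in VECTOR shape — the shape in which two `t′ = 0` W5
states transported to `t′ = tp` by their diag-hop rows (pin-1 `twoFieldNodeTT'_at_tp_down_of_twoFieldDiagHopNode`, then
`clusterCapTT'_field_{down,up}`) arrive: even unit vectors `ψᵢ` of the open `aᵢ × bᵢ` boxes with energy caps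
`Re⟨ψᵢ, A^{tp}_{C}(μᵢ, h)ψᵢ⟩ ≤ uᵢ·(aᵢbᵢ)` and INTERVAL number rows `nloᵢ·(aᵢbᵢ) ≤ Re⟨ψᵢ, Nψᵢ⟩ ≤ nhiᵢ·(aᵢbᵢ)`, box 1 below the target density
(`nhi₁ ≤ n`), box 2 above it (`n < nlo₂`). p2's mixing side condition `(n₂ − n)(u₁ + μ₁n₁) + (n − n₁)(u₂ + μ₂n₂) ≤ u(n₂ − n₁)` is
bi-affine in the two unknown exact densities, so the four corner checks `(nlo₁|nhi₁) × (nlo₂|nhi₂)` suffice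
(`exists_canonicalClass_sourced_le_of_two_clusterCapIntervalsTT'`: fix the exact upper density, `twoCap_mixing_of_endpoints_upper` at
each lower end point, then p6's interval-below `tp` theorem). §2 feeds the `hcap` to p2's exact-minimiser chain at general `t′`
(`exists_minimiser_canonicalClass`, `re_expect_localPairAt_ge_of_minimiser`): translation-invariant density-`n` minimisers of
`E^{tp}_h` exist and every one has `(lo − u)/(2h) ≤ Re ω(P₀^d)` — the shape the A0 two-W5 continuum leaves apply with four
`nlinarith` side conditions; §3 is the `t′ = 0` VECTOR-shape twin (boxes `dWaveSourceOpenBox`, proved the same way from p6's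
`exists_canonicalClass_sourced_le_of_clusterCapInterval_of_clusterCap`) for two `t′ = 0` W5 states read along their field lines.

HONEST FRAMING: bookkeeping only — no number, no certificate, no claim node; the eventual leaves are CONDITIONAL finite-field RESPONSE
floors on infinite-volume ground states at fixed density, never order parameters, no phase word, not a superconductivity verdict.
Zero compute; no definition; no named fact; no `sorry`. REUSED (not restated): p6's `twoCap_mixing_of_endpoints_upper`,
`exists_canonicalClass_sourced_le_of_clusterCapInterval_of_clusterCap[TT']`; p2's `exists_minimiser_canonicalClass`,
`re_expect_localPairAt_ge_of_minimiser`. References: D. Ruelle, *Statistical Mechanics: Rigorous Results* (1969) §3.3–3.4;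
Bratteli–Robinson I (1987) Thm. 2.3.15; Griffiths, Phys. Rev. 152 (1966) 240 §II.
-/

noncomputable section

namespace Summit.Ventures.CertifiedManyBodySolver.Observables

open Matrix Literature.Probability.LatticeModels
open Literature.MathematicalPhysics.QuantumLattice Literature.MathematicalPhysics.QuantumLattice.ThermodynamicLimit
open Literature.MathematicalPhysics.QuantumLattice.TwoCluster
open scoped ComplexOrder

section TwoIntervalsTTPrime

variable {a₁ b₁ a₂ b₂ : ℕ}

/-- **Two INTERVAL-density cluster caps of the `t–t′` box bracketing the target density ⇒ the canonical `hcap`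
(four-corner rule, general `tp`, vector shape).** Box 1 (`a₁ × b₁`, even unit `ψ₁`, cap `u₁` at `μ₁` for
`dWaveSourceOpenBoxTT' a₁ b₁ tp U μ₁ h`, number row in `[nlo₁, nhi₁]·(a₁b₁)`) lies below the target density (`nhi₁ ≤ n`), box 2
(`a₂ × b₂`, `ψ₂`, cap `u₂` at `μ₂`, number row in `[nlo₂, nhi₂]·(a₂b₂)`) above it (`n < nlo₂`); if p2's mixing condition holds at
the four corners `(nlo₁|nhi₁) × (nlo₂|nhi₂)`, some translation-invariant state of density exactly `n` has `μ = 0`-pencil sourced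
`t–t′` energy `≤ u`. [cite: Ruelle1969, §3.4] -/
theorem exists_canonicalClass_sourced_le_of_two_clusterCapIntervalsTT' (ha₁ : 0 < a₁) (hb₁ : 0 < b₁)
    (ha₂ : 0 < a₂) (hb₂ : 0 < b₂) (tp U μ₁ μ₂ h : ℝ)
    {ψ₁ : Fock (Orb (Fin a₁ ×ₗ Fin b₁))} (hψ₁ : HasParity 0 ψ₁) (h1₁ : star ψ₁ ⬝ᵥ ψ₁ = 1)
    {ψ₂ : Fock (Orb (Fin a₂ ×ₗ Fin b₂))} (hψ₂ : HasParity 0 ψ₂) (h1₂ : star ψ₂ ⬝ᵥ ψ₂ = 1)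
    {nlo₁ nhi₁ nlo₂ nhi₂ n u₁ u₂ u : ℝ}
    (hNlo₁ : nlo₁ * ((a₁ : ℝ) * b₁) ≤ (star ψ₁ ⬝ᵥ (totalNumber *ᵥ ψ₁)).re)
    (hNhi₁ : (star ψ₁ ⬝ᵥ (totalNumber *ᵥ ψ₁)).re ≤ nhi₁ * ((a₁ : ℝ) * b₁))
    (hE₁ : (star ψ₁ ⬝ᵥ (dWaveSourceOpenBoxTT' a₁ b₁ tp U μ₁ h *ᵥ ψ₁)).re ≤ u₁ * ((a₁ : ℝ) * b₁))
    (hNlo₂ : nlo₂ * ((a₂ : ℝ) * b₂) ≤ (star ψ₂ ⬝ᵥ (totalNumber *ᵥ ψ₂)).re)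
    (hNhi₂ : (star ψ₂ ⬝ᵥ (totalNumber *ᵥ ψ₂)).re ≤ nhi₂ * ((a₂ : ℝ) * b₂))
    (hE₂ : (star ψ₂ ⬝ᵥ (dWaveSourceOpenBoxTT' a₂ b₂ tp U μ₂ h *ᵥ ψ₂)).re ≤ u₂ * ((a₂ : ℝ) * b₂))
    (hhi : nhi₁ ≤ n) (hlt : n < nlo₂)
    (hll : (nlo₂ - n) * (u₁ + μ₁ * nlo₁) + (n - nlo₁) * (u₂ + μ₂ * nlo₂) ≤ u * (nlo₂ - nlo₁))
    (hlh : (nhi₂ - n) * (u₁ + μ₁ * nlo₁) + (n - nlo₁) * (u₂ + μ₂ * nhi₂) ≤ u * (nhi₂ - nlo₁))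
    (hhl : (nlo₂ - n) * (u₁ + μ₁ * nhi₁) + (n - nhi₁) * (u₂ + μ₂ * nlo₂) ≤ u * (nlo₂ - nhi₁))
    (hhh : (nhi₂ - n) * (u₁ + μ₁ * nhi₁) + (n - nhi₁) * (u₂ + μ₂ * nhi₂) ≤ u * (nhi₂ - nhi₁)) :
    ∃ σ : InfVolFermionState 2, σ.IsTranslationInvariant ∧ σ.density = n ∧
      σ.meanEnergy (hubbardTTPrimeSourcedInteraction 1 tp U 0 dWaveFormFactor h) 1 ≤ u := by
  have hab : (0 : ℝ) < (a₂ : ℝ) * b₂ := by positivity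
  set n₂ : ℝ := (star ψ₂ ⬝ᵥ (totalNumber *ᵥ ψ₂)).re / ((a₂ : ℝ) * b₂) with hn₂
  have hN₂ : (star ψ₂ ⬝ᵥ (totalNumber *ᵥ ψ₂)).re = n₂ * ((a₂ : ℝ) * b₂) := by rw [hn₂]; field_simp
  have hlo₂ : nlo₂ ≤ n₂ := (le_div_iff₀ hab).2 hNlo₂
  have hhi₂ : n₂ ≤ nhi₂ := (div_le_iff₀ hab).2 hNhi₂
  exact exists_canonicalClass_sourced_le_of_clusterCapInterval_of_clusterCapTT' ha₁ hb₁ ha₂ hb₂ tp U μ₁ μ₂ h hψ₁ h1₁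
    hψ₂ h1₂ hNlo₁ hNhi₁ hE₁ hN₂ hE₂ hhi (hlt.trans_le hlo₂)
    (twoCap_mixing_of_endpoints_upper hlo₂ hhi₂ hll hlh) (twoCap_mixing_of_endpoints_upper hlo₂ hhi₂ hhl hhh)

variable {ω : InfVolFermionState 2}

/-- **Exact-minimiser floor from two INTERVAL-density `t–t′` caps (two transported W5-class states bracketing the
target density), general `tp`.** With a certified canonical floor `lo ≤ e(1,tp,U,n)` (`U ≥ 0`, `h > 0`, `n ∈ (0,2)`),
`nhi₁ ≤ n < nlo₂` and the four corner conditions, translation-invariant density-`n` minimisers of `E^{tp}_h` EXIST and EVERY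
one has `(lo − u)/(2h) ≤ Re ω(P₀^d)`. CONDITIONAL on the caps; a finite-field RESPONSE floor, not an order parameter.
[cite: Griffiths1966, §II] [cite: BratteliRobinsonI1987, Thm. 2.3.15] -/
theorem minimiser_response_floor_of_two_clusterCapIntervalsTT' (ha₁ : 0 < a₁) (hb₁ : 0 < b₁) (ha₂ : 0 < a₂)
    (hb₂ : 0 < b₂) {tp U μ₁ μ₂ h lo nlo₁ nhi₁ nlo₂ nhi₂ n u₁ u₂ u : ℝ} (hU : 0 ≤ U) (hh : 0 < h) (hn0 : 0 < n)
    (hn2 : n < 2) (hlo : lo ≤ energyDensityTT' 1 tp U n)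
    {ψ₁ : Fock (Orb (Fin a₁ ×ₗ Fin b₁))} (hψ₁ : HasParity 0 ψ₁) (h1₁ : star ψ₁ ⬝ᵥ ψ₁ = 1)
    {ψ₂ : Fock (Orb (Fin a₂ ×ₗ Fin b₂))} (hψ₂ : HasParity 0 ψ₂) (h1₂ : star ψ₂ ⬝ᵥ ψ₂ = 1)
    (hNlo₁ : nlo₁ * ((a₁ : ℝ) * b₁) ≤ (star ψ₁ ⬝ᵥ (totalNumber *ᵥ ψ₁)).re)
    (hNhi₁ : (star ψ₁ ⬝ᵥ (totalNumber *ᵥ ψ₁)).re ≤ nhi₁ * ((a₁ : ℝ) * b₁))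
    (hE₁ : (star ψ₁ ⬝ᵥ (dWaveSourceOpenBoxTT' a₁ b₁ tp U μ₁ h *ᵥ ψ₁)).re ≤ u₁ * ((a₁ : ℝ) * b₁))
    (hNlo₂ : nlo₂ * ((a₂ : ℝ) * b₂) ≤ (star ψ₂ ⬝ᵥ (totalNumber *ᵥ ψ₂)).re)
    (hNhi₂ : (star ψ₂ ⬝ᵥ (totalNumber *ᵥ ψ₂)).re ≤ nhi₂ * ((a₂ : ℝ) * b₂))
    (hE₂ : (star ψ₂ ⬝ᵥ (dWaveSourceOpenBoxTT' a₂ b₂ tp U μ₂ h *ᵥ ψ₂)).re ≤ u₂ * ((a₂ : ℝ) * b₂))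
    (hhi : nhi₁ ≤ n) (hlt : n < nlo₂)
    (hll : (nlo₂ - n) * (u₁ + μ₁ * nlo₁) + (n - nlo₁) * (u₂ + μ₂ * nlo₂) ≤ u * (nlo₂ - nlo₁))
    (hlh : (nhi₂ - n) * (u₁ + μ₁ * nlo₁) + (n - nlo₁) * (u₂ + μ₂ * nhi₂) ≤ u * (nhi₂ - nlo₁))
    (hhl : (nlo₂ - n) * (u₁ + μ₁ * nhi₁) + (n - nhi₁) * (u₂ + μ₂ * nlo₂) ≤ u * (nlo₂ - nhi₁))
    (hhh : (nhi₂ - n) * (u₁ + μ₁ * nhi₁) + (n - nhi₁) * (u₂ + μ₂ * nhi₂) ≤ u * (nhi₂ - nhi₁)) :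
    (∃ ω : InfVolFermionState 2, ω.IsTranslationInvariant ∧ ω.density = n ∧
      ∀ ω' : InfVolFermionState 2, ω'.IsTranslationInvariant → ω'.density = n →
        ω.meanEnergy (hubbardTTPrimeSourcedInteraction 1 tp U 0 dWaveFormFactor h) 1 ≤
          ω'.meanEnergy (hubbardTTPrimeSourcedInteraction 1 tp U 0 dWaveFormFactor h) 1) ∧
    ∀ ω : InfVolFermionState 2, ω.IsTranslationInvariant → ω.density = n →
      (∀ ω' : InfVolFermionState 2, ω'.IsTranslationInvariant → ω'.density = n →
        ω.meanEnergy (hubbardTTPrimeSourcedInteraction 1 tp U 0 dWaveFormFactor h) 1 ≤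
          ω'.meanEnergy (hubbardTTPrimeSourcedInteraction 1 tp U 0 dWaveFormFactor h) 1) →
      (lo - u) / (2 * h) ≤
        (ω.expect (pairRegion (insert 0 unitSteps) 0) (localPairAt (insert 0 unitSteps) dWaveFormFactor 0)).re :=
  ⟨exists_minimiser_canonicalClass _ hn0.le hn2, fun _ hω hρ hmin =>
    re_expect_localPairAt_ge_of_minimiser hω hU hρ hn0 hn2 hh hlo hmin
      (exists_canonicalClass_sourced_le_of_two_clusterCapIntervalsTT' ha₁ hb₁ ha₂ hb₂ tp U μ₁ μ₂ h hψ₁ h1₁ hψ₂ h1₂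
        hNlo₁ hNhi₁ hE₁ hNlo₂ hNhi₂ hE₂ hhi hlt hll hlh hhl hhh)⟩

end TwoIntervalsTTPrime

section TwoIntervalsVector

variable {a₁ b₁ a₂ b₂ : ℕ}

/-- **`t′ = 0` four-corner rule in VECTOR shape** (boxes `dWaveSourceOpenBox aᵢ bᵢ U μᵢ h`; the node-shape form is p479142's
`exists_canonicalClass_sourced_le_of_two_clusterNodeIntervals`): the shape in which two `t′ = 0` W5 states read along their
field lines by `clusterCap_field_{down,up}` arrive. [cite: Ruelle1969, §3.4] -/
theorem exists_canonicalClass_sourced_le_of_two_clusterCapIntervals (ha₁ : 0 < a₁) (hb₁ : 0 < b₁)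
    (ha₂ : 0 < a₂) (hb₂ : 0 < b₂) (U μ₁ μ₂ h : ℝ)
    {ψ₁ : Fock (Orb (Fin a₁ ×ₗ Fin b₁))} (hψ₁ : HasParity 0 ψ₁) (h1₁ : star ψ₁ ⬝ᵥ ψ₁ = 1)
    {ψ₂ : Fock (Orb (Fin a₂ ×ₗ Fin b₂))} (hψ₂ : HasParity 0 ψ₂) (h1₂ : star ψ₂ ⬝ᵥ ψ₂ = 1)
    {nlo₁ nhi₁ nlo₂ nhi₂ n u₁ u₂ u : ℝ}
    (hNlo₁ : nlo₁ * ((a₁ : ℝ) * b₁) ≤ (star ψ₁ ⬝ᵥ (totalNumber *ᵥ ψ₁)).re)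
    (hNhi₁ : (star ψ₁ ⬝ᵥ (totalNumber *ᵥ ψ₁)).re ≤ nhi₁ * ((a₁ : ℝ) * b₁))
    (hE₁ : (star ψ₁ ⬝ᵥ (dWaveSourceOpenBox a₁ b₁ U μ₁ h *ᵥ ψ₁)).re ≤ u₁ * ((a₁ : ℝ) * b₁))
    (hNlo₂ : nlo₂ * ((a₂ : ℝ) * b₂) ≤ (star ψ₂ ⬝ᵥ (totalNumber *ᵥ ψ₂)).re)
    (hNhi₂ : (star ψ₂ ⬝ᵥ (totalNumber *ᵥ ψ₂)).re ≤ nhi₂ * ((a₂ : ℝ) * b₂))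
    (hE₂ : (star ψ₂ ⬝ᵥ (dWaveSourceOpenBox a₂ b₂ U μ₂ h *ᵥ ψ₂)).re ≤ u₂ * ((a₂ : ℝ) * b₂))
    (hhi : nhi₁ ≤ n) (hlt : n < nlo₂)
    (hll : (nlo₂ - n) * (u₁ + μ₁ * nlo₁) + (n - nlo₁) * (u₂ + μ₂ * nlo₂) ≤ u * (nlo₂ - nlo₁))
    (hlh : (nhi₂ - n) * (u₁ + μ₁ * nlo₁) + (n - nlo₁) * (u₂ + μ₂ * nhi₂) ≤ u * (nhi₂ - nlo₁))
    (hhl : (nlo₂ - n) * (u₁ + μ₁ * nhi₁) + (n - nhi₁) * (u₂ + μ₂ * nlo₂) ≤ u * (nlo₂ - nhi₁))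
    (hhh : (nhi₂ - n) * (u₁ + μ₁ * nhi₁) + (n - nhi₁) * (u₂ + μ₂ * nhi₂) ≤ u * (nhi₂ - nhi₁)) :
    ∃ σ : InfVolFermionState 2, σ.IsTranslationInvariant ∧ σ.density = n ∧
      σ.meanEnergy (hubbardTTPrimeSourcedInteraction 1 0 U 0 dWaveFormFactor h) 1 ≤ u := by
  have hab : (0 : ℝ) < (a₂ : ℝ) * b₂ := by positivity
  set n₂ : ℝ := (star ψ₂ ⬝ᵥ (totalNumber *ᵥ ψ₂)).re / ((a₂ : ℝ) * b₂) with hn₂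
  have hN₂ : (star ψ₂ ⬝ᵥ (totalNumber *ᵥ ψ₂)).re = n₂ * ((a₂ : ℝ) * b₂) := by rw [hn₂]; field_simp
  have hlo₂ : nlo₂ ≤ n₂ := (le_div_iff₀ hab).2 hNlo₂
  have hhi₂ : n₂ ≤ nhi₂ := (div_le_iff₀ hab).2 hNhi₂
  exact exists_canonicalClass_sourced_le_of_clusterCapInterval_of_clusterCap ha₁ hb₁ ha₂ hb₂ U μ₁ μ₂ h hψ₁ h1₁
    hψ₂ h1₂ hNlo₁ hNhi₁ hE₁ hN₂ hE₂ hhi (hlt.trans_le hlo₂)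
    (twoCap_mixing_of_endpoints_upper hlo₂ hhi₂ hll hlh) (twoCap_mixing_of_endpoints_upper hlo₂ hhi₂ hhl hhh)

end TwoIntervalsVector

end Summit.Ventures.CertifiedManyBodySolver.Observables

end
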